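import Summits.QuantumFields.YangMills.Theorems.ComplexCouplingChannelHarmonicMeasureEngineTorusLegPrelims

/-!
# Bead slide: propagating a free-energy window along a real coupling interval

Stub `stub_beadSlide` of line `Sketch` for crux `FreeEnergyWindowChannel` (item `stmt-QuantumFields-18842`,
route `ComplexCouplingChannel` of `QuantumFields/YangMills`).  Pure one-complex-variable analysis plus plane
geometry; no property of the family `Z : ℕ → ℂ → ℂ` is used.

A *window* for `Z` on a set `S` is a function `f` (holomorphic on `S`) with constants `M, P₀` such that
`Z P z ≠ 0` and `|log ‖Z P z‖ + P⁴ Re f z| ≤ M` for `P ≥ P₀`, `z ∈ S`.  Given a window on an open connected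
channel `D ∋ 0` landing cleanly on the disc `ball βs r₁ ⊆ D` (every `z ∈ D` with `Re z ≥ βs`, `|Im z| < r₁/2`
lies in that disc) and local windows on balls around every real point of `[βs, β]`, we produce a window on an
open connected set containing `0` and `β`.

Proof.  Two windows on a common set have functions with equal real parts (divide by `P⁴`, let `P → ∞`),
so on an open preconnected overlap the functions differ by an imaginary constant (open mapping theorem) and
can be patched (`exists_window_union`).  A Lebesgue number `ℓ` of the cover of the compact segment `[βs, β] ⊆ ℂ` by the
local balls gives beads `B_k = ball (βs + kρ) ρ`, `ρ = min ℓ (r₁/2)`, each inside a local ball; we patch them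
one at a time onto `U_0 := D`, keeping the invariant `D ∪ B_k ⊆ U_k ⊆ D ∪ {Re z ≤ βs + kρ} ∪ B_k`, under which
the next overlap `U_k ∩ B_{k+1}` is `(ball βs r₁ ∩ B_{k+1}) ∪ (B_k ∩ B_{k+1})`, a union of two convex sets
sharing a real point, hence preconnected.  After `N = ⌊(β - βs)/ρ⌋` steps the bead `B_N ∋ β` is attached.
-/

open Complex Metric Set Filter Topology

namespace Summit.QuantumFields.YangMills.Theorems.FreeEnergyWindowChannel

/-- Two window bounds at one point force equal real parts: if `|L P + P⁴ a| ≤ M` and `|L P + P⁴ b| ≤ M'`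
for all large `P`, then `a = b` (archimedean property). -/
theorem eq_of_abs_add_pow_four_mul_le {L : ℕ → ℝ} {a b M M' : ℝ} {P₀ P₁ : ℕ}
    (ha : ∀ P : ℕ, P₀ ≤ P → |L P + (P : ℝ) ^ 4 * a| ≤ M)
    (hb : ∀ P : ℕ, P₁ ≤ P → |L P + (P : ℝ) ^ 4 * b| ≤ M') : a = b := by
  by_contra hne
  have hd : 0 < |a - b| := abs_pos.2 (sub_ne_zero.2 hne)
  obtain ⟨n, hn⟩ := exists_nat_gt ((M + M') / |a - b|)
  rw [div_lt_iff₀ hd] at hn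
  have h1 := ha (max n (max P₀ P₁)) (le_trans (le_max_left _ _) (le_max_right _ _))
  have h2 := hb (max n (max P₀ P₁)) (le_trans (le_max_right _ _) (le_max_right _ _))
  set P : ℕ := max n (max P₀ P₁)
  have hnP : (n : ℝ) ≤ (P : ℝ) ^ 4 := by
    exact_mod_cast (le_max_left n (max P₀ P₁)).trans (Nat.le_self_pow (by norm_num) P)
  have h3 : (P : ℝ) ^ 4 * |a - b| ≤ M + M' := by
    rw [← abs_of_nonneg (by positivity : (0 : ℝ) ≤ (P : ℝ) ^ 4), ← abs_mul, mul_sub]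
    calc |(P : ℝ) ^ 4 * a - (P : ℝ) ^ 4 * b| = |(L P + (P : ℝ) ^ 4 * a) - (L P + (P : ℝ) ^ 4 * b)| := by
          ring_nf
      _ ≤ M + M' := (abs_sub _ _).trans (add_le_add h1 h2)
  nlinarith

/-- A holomorphic function with vanishing real part on an open preconnected set is an imaginary constant
(open mapping theorem: a non-constant holomorphic map is open, and the imaginary axis has empty interior).
Variant of `ComplexCouplingChannel.exists_eq_const_of_re_eq_zero` (balls) for preconnected open sets. -/
theorem exists_eq_const_of_re_eq_zero_of_isPreconnected {u : ℂ → ℂ} {O : Set ℂ} (hO : IsOpen O)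
    (hOc : IsPreconnected O) (hu : DifferentiableOn ℂ u O) (hre : ∀ z ∈ O, (u z).re = 0) :
    ∃ w : ℂ, w.re = 0 ∧ ∀ z ∈ O, u z = w := by
  rcases O.eq_empty_or_nonempty with rfl | ⟨x, hx⟩
  · exact ⟨0, rfl, fun z hz => hz.elim⟩
  rcases (hu.analyticOnNhd hO).is_constant_or_isOpen hOc with ⟨w, hw⟩ | hopen
  · exact ⟨w, by rw [← hw x hx]; exact hre x hx, hw⟩
  · exfalso
    obtain ⟨ε, hε0, hε⟩ := Metric.isOpen_iff.1 (hopen _ Subset.rfl hO) (u x) (mem_image_of_mem u hx)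
    obtain ⟨z, hz, hzx⟩ : u x + (ε / 2 : ℝ) ∈ u '' O := by
      refine hε ?_
      rw [mem_ball, dist_eq_norm, add_sub_cancel_left, norm_real, Real.norm_eq_abs,
        abs_of_pos (by positivity)]
      linarith
    have h1 := hre z hz
    rw [hzx, add_re, ofReal_re, hre x hx] at h1
    linarith

/-- **Patching two windows.**  Windows `(f, M, P₀)` on an open `U` and `(g, M', P₁)` on an open `B` with
preconnected overlap `U ∩ B` glue to a window on `U ∪ B`: on the overlap `Re f = Re g`, so `g - f` is an
imaginary constant `w` there, and `U.piecewise f (g - w)` is holomorphic on `U ∪ B` with the same real parts. -/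
theorem exists_window_union {Z : ℕ → ℂ → ℂ} {U B : Set ℂ} {f g : ℂ → ℂ} {M M' : ℝ} {P₀ P₁ : ℕ}
    (hU : IsOpen U) (hB : IsOpen B) (hO : IsPreconnected (U ∩ B))
    (hf : DifferentiableOn ℂ f U) (hg : DifferentiableOn ℂ g B)
    (hwf : ∀ P : ℕ, P₀ ≤ P → ∀ z ∈ U, Z P z ≠ 0 ∧ |Real.log ‖Z P z‖ + (P : ℝ) ^ 4 * (f z).re| ≤ M)
    (hwg : ∀ P : ℕ, P₁ ≤ P → ∀ z ∈ B, Z P z ≠ 0 ∧ |Real.log ‖Z P z‖ + (P : ℝ) ^ 4 * (g z).re| ≤ M') :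
    ∃ h : ℂ → ℂ, DifferentiableOn ℂ h (U ∪ B) ∧ ∃ M₂ : ℝ, ∃ P₂ : ℕ, ∀ P : ℕ, P₂ ≤ P → ∀ z ∈ U ∪ B,
      Z P z ≠ 0 ∧ |Real.log ‖Z P z‖ + (P : ℝ) ^ 4 * (h z).re| ≤ M₂ := by
  classical
  have hre : ∀ z ∈ U ∩ B, ((fun z => g z - f z) z).re = 0 := fun z hz => by
    rw [sub_re, sub_eq_zero]
    exact (eq_of_abs_add_pow_four_mul_le (fun P hP => (hwf P hP z hz.1).2)
      (fun P hP => (hwg P hP z hz.2).2)).symm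
  obtain ⟨w, hw0, hw⟩ := exists_eq_const_of_re_eq_zero_of_isPreconnected (hU.inter hB) hO
    ((hg.mono inter_subset_right).sub (hf.mono inter_subset_left)) hre
  refine ⟨U.piecewise f (fun z => g z - w), ?_, max M M', max P₀ P₁, fun P hP z hz => ?_⟩
  · rintro z (hz | hz)
    · refine ((hf.differentiableAt (hU.mem_nhds hz)).congr_of_eventuallyEq ?_).differentiableWithinAt
      exact eventuallyEq_of_mem (hU.mem_nhds hz) fun y hy => U.piecewise_eq_of_mem _ _ hy
    · refine (((hg.sub_const w).differentiableAt (hB.mem_nhds hz)).congr_of_eventuallyEq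
        ?_).differentiableWithinAt
      refine eventuallyEq_of_mem (hB.mem_nhds hz) fun y hy => ?_
      by_cases hyU : y ∈ U
      · rw [U.piecewise_eq_of_mem _ _ hyU, ← hw y ⟨hyU, hy⟩, Pi.sub_apply]
        ring
      · exact U.piecewise_eq_of_notMem _ _ hyU
  · by_cases hzU : z ∈ U
    · rw [U.piecewise_eq_of_mem _ _ hzU]
      have h1 := hwf P (le_trans (le_max_left _ _) hP) z hzU
      exact ⟨h1.1, h1.2.trans (le_max_left _ _)⟩
    · rw [U.piecewise_eq_of_notMem _ _ hzU, sub_re, hw0, sub_zero]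
      have h1 := hwg P (le_trans (le_max_right _ _) hP) z (hz.resolve_left hzU)
      exact ⟨h1.1, h1.2.trans (le_max_right _ _)⟩

/-- A point of a complex ball with real centre has real and imaginary parts within the radius. -/
theorem abs_re_sub_lt_of_mem_ball {z : ℂ} {a r : ℝ} (h : z ∈ ball (a : ℂ) r) :
    |z.re - a| < r ∧ |z.im| < r := by
  rw [mem_ball, dist_eq_norm] at h
  exact ⟨lt_of_le_of_lt (by simpa using abs_re_le_norm (z - a)) h,
    lt_of_le_of_lt (by simpa using abs_im_le_norm (z - a)) h⟩

/-- A real point lies in a complex ball with real centre iff it lies in the real ball. -/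
theorem ofReal_mem_ball_ofReal_iff {p a r : ℝ} : (p : ℂ) ∈ ball (a : ℂ) r ↔ |p - a| < r := by
  rw [mem_ball, dist_of_im_eq (by simp), ofReal_re, ofReal_re, Real.dist_eq]

/-- **One bead step (geometry).**  With `B = ball c ρ`, `B' = ball (c + ρ) ρ`, `βs ≤ c`, `ρ ≤ r₁/2` and the
clean landing of `D` on `ball βs r₁`, a set `U` with `D ∪ B ⊆ U ⊆ D ∪ {Re z ≤ c} ∪ B` meets `B'` in the
preconnected nonempty set `(ball βs r₁ ∩ B') ∪ (B ∩ B')`, and `U ∪ B' ⊆ D ∪ {Re z ≤ c + ρ} ∪ B'`. -/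
theorem bead_step {βs r₁ ρ c : ℝ} (hρ : 0 < ρ) (hρr : ρ ≤ r₁ / 2) (hc : βs ≤ c) {D U : Set ℂ}
    (hball : ball (βs : ℂ) r₁ ⊆ D)
    (hclean : ∀ z ∈ D, βs ≤ z.re → |z.im| < r₁ / 2 → z ∈ ball (βs : ℂ) r₁)
    (hDU : D ⊆ U) (hBU : ball (c : ℂ) ρ ⊆ U) (hUsub : U ⊆ D ∪ {z | z.re ≤ c} ∪ ball (c : ℂ) ρ) :
    IsPreconnected (U ∩ ball ((c + ρ : ℝ) : ℂ) ρ) ∧ (U ∩ ball ((c + ρ : ℝ) : ℂ) ρ).Nonempty ∧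
      U ∪ ball ((c + ρ : ℝ) : ℂ) ρ ⊆ D ∪ {z | z.re ≤ c + ρ} ∪ ball ((c + ρ : ℝ) : ℂ) ρ := by
  have hconv : IsPreconnected (ball (c : ℂ) ρ ∩ ball ((c + ρ : ℝ) : ℂ) ρ) :=
    ((convex_ball _ _).inter (convex_ball _ _)).isPreconnected
  -- the overlap
  have hO : U ∩ ball ((c + ρ : ℝ) : ℂ) ρ =
      (ball (βs : ℂ) r₁ ∩ ball ((c + ρ : ℝ) : ℂ) ρ) ∪ (ball (c : ℂ) ρ ∩ ball ((c + ρ : ℝ) : ℂ) ρ) := by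
    ext z
    constructor
    · rintro ⟨hzU, hzB'⟩
      have h1 := abs_re_sub_lt_of_mem_ball hzB'
      have h2 := abs_sub_lt_iff.1 h1.1
      rcases hUsub hzU with (hzD | hzre) | hzB
      · exact Or.inl ⟨hclean z hzD (by linarith) (by linarith [h1.2]), hzB'⟩
      · exact absurd hzre (by simp only [mem_setOf_eq, not_le]; linarith)
      · exact Or.inr ⟨hzB, hzB'⟩
    · rintro (⟨hz1, hz2⟩ | ⟨hz1, hz2⟩)
      exacts [⟨hDU (hball hz1), hz2⟩, ⟨hBU hz1, hz2⟩]
  -- the real midpoint of the two beads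
  have hmB : ((c + ρ / 2 : ℝ) : ℂ) ∈ ball (c : ℂ) ρ := by
    rw [ofReal_mem_ball_ofReal_iff, abs_sub_lt_iff]; constructor <;> linarith
  have hmB' : ((c + ρ / 2 : ℝ) : ℂ) ∈ ball ((c + ρ : ℝ) : ℂ) ρ := by
    rw [ofReal_mem_ball_ofReal_iff, abs_sub_lt_iff]; constructor <;> linarith
  refine ⟨?_, ⟨_, hBU hmB, hmB'⟩, ?_⟩
  · rw [hO]
    rcases (ball (βs : ℂ) r₁ ∩ ball ((c + ρ : ℝ) : ℂ) ρ).eq_empty_or_nonempty with h0 | ⟨z, hz1, hz2⟩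
    · rwa [h0, empty_union]
    · -- a common real point `p` of the two convex pieces
      have h1 := abs_sub_lt_iff.1 (abs_re_sub_lt_of_mem_ball hz1).1
      have h2 := abs_sub_lt_iff.1 (abs_re_sub_lt_of_mem_ball hz2).1
      have hp1 : min z.re (c + ρ / 2) ≤ z.re := min_le_left _ _
      have hp2 : min z.re (c + ρ / 2) ≤ c + ρ / 2 := min_le_right _ _
      have hp3 : c < min z.re (c + ρ / 2) := lt_min (by linarith) (by linarith)
      refine IsPreconnected.union ((min z.re (c + ρ / 2) : ℝ) : ℂ) ⟨?_, ?_⟩ ⟨?_, ?_⟩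
        ((convex_ball _ _).inter (convex_ball _ _)).isPreconnected hconv
      all_goals rw [ofReal_mem_ball_ofReal_iff, abs_sub_lt_iff]; constructor <;> linarith
  · rintro z (hzU | hzB')
    · rcases hUsub hzU with (hzD | hzre) | hzB
      · exact Or.inl (Or.inl hzD)
      · refine Or.inl (Or.inr ?_)
        simp only [mem_setOf_eq] at hzre ⊢
        linarith
      · refine Or.inl (Or.inr ?_)
        have h1 := abs_sub_lt_iff.1 (abs_re_sub_lt_of_mem_ball hzB).1
        simp only [mem_setOf_eq]
        linarith
    · exact Or.inr hzB'

/-- **Bead slide** (stub `stub_beadSlide` of line `Sketch`, crux `FreeEnergyWindowChannel`).  A window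
channel `D ∋ 0` with a clean landing at `βs` (`ball βs r₁ ⊆ D`; every `z ∈ D` with `Re z ≥ βs`,
`|Im z| < r₁/2` lies in `ball βs r₁`), plus local windows at every real point of `[βs, β]`, give a window on
an open connected set containing `0` and `β`.  Proof: Lebesgue number of the cover of the compact segment
`[βs, β] ⊆ ℂ` by the local balls; beads `ball (βs + kρ) ρ`, `ρ = min ℓ (r₁/2)`, `k ≤ N = ⌊(β - βs)/ρ⌋`, patched
one at a time onto `D` (`exists_window_union`, `bead_step`).  No property of `Z` is used. -/
theorem stub_beadSlide :
    ∀ (Z : ℕ → ℂ → ℂ) (βs β r₁ : ℝ), βs ≤ β → 0 < r₁ →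
      ∀ D : Set ℂ, IsOpen D → IsConnected D → (0 : ℂ) ∈ D → Metric.ball (βs : ℂ) r₁ ⊆ D →
      (∀ z ∈ D, βs ≤ z.re → |z.im| < r₁ / 2 → z ∈ Metric.ball (βs : ℂ) r₁) →
      ∀ f : ℂ → ℂ, DifferentiableOn ℂ f D → ∀ (M : ℝ) (P₀ : ℕ),
      (∀ P : ℕ, P₀ ≤ P → ∀ z ∈ D, Z P z ≠ 0 ∧ |Real.log ‖Z P z‖ + (P : ℝ) ^ 4 * (f z).re| ≤ M) →
      (∀ x : ℝ, x ∈ Set.Icc βs β → ∃ δ : ℝ, 0 < δ ∧ ∃ g : ℂ → ℂ, DifferentiableOn ℂ g (Metric.ball (x : ℂ) δ) ∧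
        ∃ M' : ℝ, ∃ P₁ : ℕ, ∀ P : ℕ, P₁ ≤ P → ∀ z ∈ Metric.ball (x : ℂ) δ,
          Z P z ≠ 0 ∧ |Real.log ‖Z P z‖ + (P : ℝ) ^ 4 * (g z).re| ≤ M') →
      ∃ D' : Set ℂ, IsOpen D' ∧ IsConnected D' ∧ (0 : ℂ) ∈ D' ∧ (β : ℂ) ∈ D' ∧
        ∃ g : ℂ → ℂ, DifferentiableOn ℂ g D' ∧ ∃ M' : ℝ, ∃ P₁ : ℕ, ∀ P : ℕ, P₁ ≤ P → ∀ z ∈ D',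
          Z P z ≠ 0 ∧ |Real.log ‖Z P z‖ + (P : ℝ) ^ 4 * (g z).re| ≤ M' := by
  intro Z βs β r₁ hβ hr₁ D hDo hDc h0D hballD hclean f hf M P₀ hW hloc
  choose! δ hδ g hg M' P₁ hWloc using hloc
  -- Lebesgue number of the cover of the compact segment `[βs, β] ⊆ ℂ` by the local balls
  obtain ⟨ℓ, hℓ0, hℓ⟩ := lebesgue_number_lemma_of_metric (ι := Icc βs β)
    (c := fun x => ball ((x : ℝ) : ℂ) (δ x)) (isCompact_Icc.image continuous_ofReal)
    (fun _ => isOpen_ball) (by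
      rintro _ ⟨x, hx, rfl⟩
      exact mem_iUnion.2 ⟨⟨x, hx⟩, mem_ball_self (hδ x hx)⟩)
  obtain ⟨ρ, hρ0, hρℓ, hρr⟩ : ∃ ρ : ℝ, 0 < ρ ∧ ρ ≤ ℓ ∧ ρ ≤ r₁ / 2 :=
    ⟨min ℓ (r₁ / 2), lt_min hℓ0 (half_pos hr₁), min_le_left _ _, min_le_right _ _⟩
  obtain ⟨N, hN1, hN2⟩ : ∃ N : ℕ, βs + N * ρ ≤ β ∧ β < βs + N * ρ + ρ := by
    refine ⟨⌊(β - βs) / ρ⌋₊, ?_, ?_⟩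
    · have h1 := Nat.floor_le (div_nonneg (sub_nonneg.2 hβ) hρ0.le)
      rw [le_div_iff₀ hρ0] at h1
      linarith
    · have h1 := Nat.lt_floor_add_one ((β - βs) / ρ)
      rw [div_lt_iff₀ hρ0] at h1
      linarith
  -- the local window carried by the bead centred at `βs + k ρ`, `k ≤ N`
  have hbead : ∀ k : ℕ, k ≤ N → ∃ g' : ℂ → ℂ, DifferentiableOn ℂ g' (ball ((βs + k * ρ : ℝ) : ℂ) ρ) ∧
      ∃ M'' : ℝ, ∃ P'' : ℕ, ∀ P : ℕ, P'' ≤ P → ∀ z ∈ ball ((βs + k * ρ : ℝ) : ℂ) ρ,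
        Z P z ≠ 0 ∧ |Real.log ‖Z P z‖ + (P : ℝ) ^ 4 * (g' z).re| ≤ M'' := by
    intro k hk
    have hk' : (k : ℝ) * ρ ≤ N * ρ := mul_le_mul_of_nonneg_right (Nat.cast_le.2 hk) hρ0.le
    have hmem : βs + k * ρ ∈ Icc βs β := ⟨le_add_of_nonneg_right (by positivity), by linarith⟩
    obtain ⟨i, hi⟩ := hℓ _ ⟨_, hmem, rfl⟩
    have hsub : ball ((βs + k * ρ : ℝ) : ℂ) ρ ⊆ ball ((i : ℝ) : ℂ) (δ i) := (ball_subset_ball hρℓ).trans hi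
    exact ⟨g i, (hg i i.2).mono hsub, M' i, P₁ i, fun P hP z hz => hWloc i i.2 P hP z (hsub hz)⟩
  -- induction along the beads
  have key : ∀ k : ℕ, k ≤ N → ∃ U : Set ℂ, IsOpen U ∧ IsConnected U ∧ D ⊆ U ∧
      ball ((βs + k * ρ : ℝ) : ℂ) ρ ⊆ U ∧
      U ⊆ D ∪ {z | z.re ≤ βs + k * ρ} ∪ ball ((βs + k * ρ : ℝ) : ℂ) ρ ∧
      ∃ h : ℂ → ℂ, DifferentiableOn ℂ h U ∧ ∃ M₂ : ℝ, ∃ P₂ : ℕ, ∀ P : ℕ, P₂ ≤ P → ∀ z ∈ U,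
        Z P z ≠ 0 ∧ |Real.log ‖Z P z‖ + (P : ℝ) ^ 4 * (h z).re| ≤ M₂ := by
    intro k
    induction k with
    | zero =>
      intro _
      refine ⟨D, hDo, hDc, Subset.rfl, ?_, fun z hz => Or.inl (Or.inl hz), f, hf, M, P₀, hW⟩
      have h1 : ball ((βs + ((0 : ℕ) : ℝ) * ρ : ℝ) : ℂ) ρ ⊆ ball (βs : ℂ) r₁ := by
        rw [Nat.cast_zero, zero_mul, add_zero]
        exact ball_subset_ball (by linarith)
      exact h1.trans hballD
    | succ k ih =>
      intro hk
      obtain ⟨U, hUo, hUc, hDU, hBU, hUsub, h, hh, M₂, P₂, hWU⟩ := ih (Nat.le_of_succ_le hk)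
      obtain ⟨g', hg', M₃, P₃, hWg⟩ := hbead (k + 1) hk
      have e : βs + ((k + 1 : ℕ) : ℝ) * ρ = βs + k * ρ + ρ := by
        push_cast
        ring
      rw [e] at hg' hWg ⊢
      obtain ⟨hpre, hne, hsub'⟩ := bead_step hρ0 hρr (le_add_of_nonneg_right (by positivity))
        hballD hclean hDU hBU hUsub
      obtain ⟨h', hh', M₄, P₄, hW'⟩ := exists_window_union hUo isOpen_ball hpre hh hg' hWU hWg
      exact ⟨U ∪ ball _ ρ, hUo.union isOpen_ball,
        hUc.union hne ⟨nonempty_ball.2 hρ0, (convex_ball _ _).isPreconnected⟩,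
        hDU.trans subset_union_left, subset_union_right, hsub', h', hh', M₄, P₄, hW'⟩
  obtain ⟨U, hUo, hUc, hDU, hBU, -, h, hh, M₂, P₂, hWU⟩ := key N le_rfl
  refine ⟨U, hUo, hUc, hDU h0D, hBU ?_, h, hh, M₂, P₂, hWU⟩
  rw [ofReal_mem_ball_ofReal_iff, abs_sub_lt_iff]
  constructor <;> linarith

end Summit.QuantumFields.YangMills.Theorems.FreeEnergyWindowChannel
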